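/-
Copyright: cell `pub-ymgap` (HUMAN RULING D-0062), Track A of `YM-PLAN.md`, DAG node N20 (= NE7b); R134 acceleration seat
`pub-ymgap-dag-n20-c` (strategy s1, generation 4), module 20.  Released under the licence of the surrounding project.
-/
import Summits.QuantumFields.YangMills.Theorems.BalabanUVNodesN20LCSLargeFieldFamilies
import Summits.QuantumFields.BalabanUV.T4Continuum.Spine.NE7b.LocalConditionalStability
import HarnessLib

/-!
# YM-DAG node N20 (= NE7b), strategy s1, module 20: THE TWO HALVES OF «LCS-j» — `PointwiseExtraction` AND `LocCondStability` — JOINTLY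
# INHABITED, BY NAME, AT CUTOFF 1 for the pinned (3.2) large-field labels of Bałaban's step weights of record

Track A of `YM-PLAN.md` (cell `pub-ymgap`, HUMAN RULING D-0062), node **N20** = spine estimate NE7b (`T4WeightBudget.RelWeightBound` — NOT PRINTED,
NOT PROVED).  Seat `pub-ymgap-dag-n20-c` (R134, s1 «the `LocCondStability` INSTANCE (+ `PointwiseExtraction`, window ledger) for Bałaban's tower at a
pinned 𝐑𝐓 step»), generation 4, module 20 (17–19 = `…N20LCSLargeField{Labels,FirstStep,Families}`).  Kernel theorems only: 0 `def`, 0 `sorry`,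
standard axioms; COUNT-NEUTRAL; `--supports` the K3‴ item.  Nothing of Bałaban's is asserted.

WHAT.  The (α)-road types «LCS-j» as TWO named `Prop`s over an abstract history tower (`Spine/NE7b/LocalConditionalStability`): `PointwiseExtraction
T S K χ M a` (the pinned choices' step kernels sum to `≤ e^{−a}·M` pointwise) and `LocCondStability T S K μ ρ₀ M b` (the carrier `M` is integrable
against the history term and has conditional expectation `≤ e^{b}` in the term's own state); `hrel_of_LCS` ∘ `sum_admS_integral_le_of_LCS` turn them,
with the `hstep` identities and the cost–volume inequality `c ≤ Σ(a − b)`, into the class weight bound.  Generation 2's module 7 inhabited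
`LocCondStability` at cutoff `1` for exponential plaquette-energy carriers (`N20LCSAtRecordLevelZero.locCondStability_one_of_record`).  THIS FILE inhabits
BOTH `Prop`s AT ONCE, for the SAME carrier, at cutoff `1`, for the pinned event «the new large-field family `P₁` contains the cubes `D`» of NODE 00's
step weights of record:
* `sum_ωOfRecord_filter_superset_le_exp_mul_indicator` — on the graph `V′ = Ū` and modulo `IsZetaAbsLeOne` + the regularity letters,
  `Σ_{t : D ⊆ P(t)} ω s t (U,Ū) ≤ e^{−a}·(e^{a}·𝟙[∀ c∈D, ∃ p′∈R c, ε″ ≤ |Ū(∂p′)−1|](U))` for EVERY `a` (module 19's product of complement factors is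
  dominated by the indicator of the simultaneous coarse large-field event: half (i) with the carrier `M = e^{a}·𝟙_{event}`);
* `integral_exp_mul_indicator_rhoZero_le` — both conjuncts of half (ii) at level `0` for that carrier: `M·ρ₀` integrable and
  `∫ M ρ₀ ≤ e^{a}·(m·e^{Cδ₀ − δ₀g₀⁻²ε″²∕(2N)})^{#D}·∫ρ₀` (pairwise disjoint letter regions of `≤ m` plaquettes; n20-d's cells Peierls bound);
* ★★★ **`halves_one_of_record`** — for EVERY history tower `T` over `cfgOfRecord F N K ·` (any choice type, any good classes), every pattern `S`,
  every level measures with `μ 0 = ∏dU`, every step-kernel family `χ` whose pinned level-`0` kernel sum READS the family-pinned label sum of the record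
  on the graph (`hread`, the identification a label-indexed instance makes by `rfl`), the carrier family with level-`0` member
  `e^{a 0 g}·𝟙_{event}` and exponents with `e^{a 0 g}·(m·r)^{#D} ≤ e^{b 0 g}`:
  `PointwiseExtraction T S 1 χ M a ∧ LocCondStability T S 1 μ (rhoZeroOfRecord F N K g₀ E) M b`
  — so `b − a = #D·(Cδ₀ + log m − δ₀g₀⁻²ε″²∕(2N))` is admissible, NEGATIVE for `ε″ ≫ g₀`: at the first pinned step the extracted cost beats the
  volume cost by `#D` Peierls exponents, in the (α)-road's own currency.

HONEST FRAMING.  Cutoff `1` (the level-`0` clause of both `Prop`s; at levels `j ≥ 1` `LocCondStability` is the located residual of Bałaban's kind,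
(A1c) — UNCHANGED); the `hstep` identities of the instance's tower are NOT supplied here (module 3 gives their graph form for NODE 00's T-step; the
tower object is the planners' ∕ (A1c)'s); label-indexed reading (`hread`); two displayed letters (`IsZetaAbsLeOne`; the [Balaban1985PropagatorsII]
Thm 1 regularity letter per pinned cube, NOT asserted); disjoint letter regions.  NE7b NOT PRINTED ∕ NOT PROVED; (α)-instance 0∕1 (this is its
level-`0` clause for the pinned (3.2) label event, not the instance); N20 NOT discharged; typed 28∕28, discharged count untouched; one finite four-torus
at fixed `ε` — NOT ℝ⁴, NOT infinite volume, NOT OS, NOT a mass gap, NOT Clay.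

References: T. Bałaban, CMP 119 (1988) 243–285 [Balaban1988Convergent] ((3.2) p. 265); CMP 99 (1985) 389–434 [Balaban1985PropagatorsII] (Thm 1);
CMP 122 (1989) 175–202 [Balaban1989LargeFieldI] ((0.1) p. 175, (0.3)–(0.5) pp. 176–177); CMP 122 (1989) 355–392 [Balaban1989LargeFieldII]
((1.79)–(1.80) pp. 383–384).
-/

set_option autoImplicit false

noncomputable section

open scoped BigOperators

namespace Summit.QuantumFields.YangMills.BalabanUVNodes.N20LCSLargeFieldHalves

open MeasureTheory
open Literature.MathematicalPhysics.QuantumFieldTheory.Balaban1983to89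
open Literature.MathematicalPhysics.QuantumFieldTheory.Balaban1983to89.T4Continuum
open Literature.MathematicalPhysics.QuantumFieldTheory.Balaban1983to89.Node00
open Summit.QuantumFields.BalabanUV.T4Continuum.B16HistoryIndexedRepr (GoodClass)
open Summit.QuantumFields.BalabanUV.T4Continuum.B16HistoryReprChain (Tower)
open Summit.QuantumFields.BalabanUV.T4Continuum.NE7b.PrefixExtraction (admS)
open Summit.QuantumFields.BalabanUV.T4Continuum.NE7b.LocalConditionalStability (LocCondStability PointwiseExtraction)
open Summit.QuantumFields.YangMills.BalabanUVNodes.N20LCSLargeFieldFirstStep (setIntegral_rhoZeroOfRecord)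
open Summit.QuantumFields.YangMills.BalabanUVNodes.N20LCSLargeFieldFamilies
  (abs_sum_ωOfRecord_filter_superset_le prod_one_sub_chiFactor_le_indicator measurableSet_forall_exists_largeField)

variable (F : T4Family) (N : ℕ) [NeZero N] (ν : Stage7Numerics) (M : ℕ) (p : B12.RunParams) (g : ℕ → ℝ)

/-- **THE EXTRACTED CARRIER OF THE PINNED (3.2) FAMILY IS AN INDICATOR ON THE GRAPH**: pointwise, modulo `IsZetaAbsLeOne` and the regularity
letters, `Σ_{t : D ⊆ P(t)} ω s t (U,Ū) ≤ e^{−a}·(e^{a}·𝟙[∀ c∈D, ∃ p′∈R c, ε″ ≤ |Ū(∂p′)−1|](U))` for EVERY exponent `a` — the shape of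
`PointwiseExtraction` with the carrier `M = e^{a}·𝟙_{event}` (the Chebyshev split is trivial for an indicator event; all content moves to the
conditional expectation of `M`, `LocalConditionalStability.PointwiseExtraction`'s docstring). [folklore] -/
theorem sum_ωOfRecord_filter_superset_le_exp_mul_indicator (k : ℕ) (A₁ : ℝ) {ζ : ZetaOfRecord F N ν M}
    (hζ : IsZetaAbsLeOne F N ν M ζ) (s : SeqOfRecord F ν M g p.K k) (D : Finset (Iχ F ν p g k))
    (R : Iχ F ν p g k → Finset (Plaq (F.P p.K) (k + 1))) (ε'' : ℝ)
    (hreg : ∀ c ∈ D, ∀ V' : GaugeField (F.P p.K) (k + 1) (SU N),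
      (∀ p' ∈ R c, dist1 (GaugeField.plaqHol V' p') < ε'') → chiFactor F N ν p g k c V' = 1)
    (a : ℝ) (U : GaugeField (F.P p.K) k (SU N)) :
    ∑ t ∈ Finset.univ.filter (fun t : LbOfRecord F ν p g k => D ⊆ t.1),
        ωOfRecord F N ν M p g k A₁ ζ s t U ((avOfRecord F N p.K k).avg U) ≤
      Real.exp (-a) * (Real.exp a *
        Set.indicator {U : GaugeField (F.P p.K) k (SU N) |
          ∀ c ∈ D, ∃ p' ∈ R c, ε'' ≤ dist1 (GaugeField.plaqHol ((avOfRecord F N p.K k).avg U) p')} (fun _ => (1 : ℝ)) U) := by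
  rw [← mul_assoc, ← Real.exp_add, neg_add_cancel, Real.exp_zero, one_mul]
  have h := (le_abs_self _).trans ((abs_sum_ωOfRecord_filter_superset_le F N ν M p g k A₁ hζ s D U _).trans
    (prod_one_sub_chiFactor_le_indicator F N ν p g k D R ε'' hreg ((avOfRecord F N p.K k).avg U)))
  refine h.trans (le_of_eq ?_)
  by_cases hU : ∀ c ∈ D, ∃ p' ∈ R c, ε'' ≤ dist1 (GaugeField.plaqHol ((avOfRecord F N p.K k).avg U) p')
  · rw [Set.indicator_of_mem (show (avOfRecord F N p.K k).avg U ∈ {V' : GaugeField (F.P p.K) (k + 1) (SU N) |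
        ∀ c ∈ D, ∃ p' ∈ R c, ε'' ≤ dist1 (GaugeField.plaqHol V' p')} from hU),
      Set.indicator_of_mem (show U ∈ {U : GaugeField (F.P p.K) k (SU N) |
        ∀ c ∈ D, ∃ p' ∈ R c, ε'' ≤ dist1 (GaugeField.plaqHol ((avOfRecord F N p.K k).avg U) p')} from hU)]
  · rw [Set.indicator_of_notMem (show (avOfRecord F N p.K k).avg U ∉ {V' : GaugeField (F.P p.K) (k + 1) (SU N) |
        ∀ c ∈ D, ∃ p' ∈ R c, ε'' ≤ dist1 (GaugeField.plaqHol V' p')} from hU),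
      Set.indicator_of_notMem (show U ∉ {U : GaugeField (F.P p.K) k (SU N) |
        ∀ c ∈ D, ∃ p' ∈ R c, ε'' ≤ dist1 (GaugeField.plaqHol ((avOfRecord F N p.K k).avg U) p')} from hU)]

/-- **THE INDICATOR CARRIER HAS CONDITIONAL EXPECTATION `≤ (m·e^{Cδ₀ − δ₀g₀⁻²ε″²∕(2N)})^{#D}` IN `ρ₀`'s STATE** (first step; pairwise disjoint letter
regions of at most `m` plaquettes): both conjuncts of `LocCondStability`'s level-`0` clause for the carrier `M = e^{a}·𝟙_{event}` — integrability and
`∫ M ρ₀ ≤ e^{a}·(m·r)^{#D}·∫ρ₀`. [folklore] -/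
theorem integral_exp_mul_indicator_rhoZero_le :
    ∃ δ₀ : ℝ, 0 < δ₀ ∧ ∃ C : ℝ, 0 ≤ C ∧ ∀ (_hK : 1 ≤ p.K) (g₀ E : ℝ), 4 * N ≤ g₀⁻¹ ^ 2 →
      ∀ (D : Finset (Iχ F ν p g 0)) (R : Iχ F ν p g 0 → Finset (Plaq (F.P p.K) 1)) (m : ℕ) (ε'' : ℝ), 0 ≤ ε'' →
        (∀ c ∈ D, (R c).card ≤ m) → (∀ c₁ ∈ D, ∀ c₂ ∈ D, c₁ ≠ c₂ → Disjoint (R c₁) (R c₂)) → ∀ (a : ℝ),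
        Integrable (fun U => (Real.exp a *
            Set.indicator {U : GaugeField (F.P p.K) 0 (SU N) |
              ∀ c ∈ D, ∃ p' ∈ R c, ε'' ≤ dist1 (GaugeField.plaqHol ((avOfRecord F N p.K 0).avg U) p')} (fun _ => (1 : ℝ)) U) *
            rhoZeroOfRecord F N p.K g₀ E U) (fieldMeasure (F.P p.K) 0 (SU N)) ∧
        ∫ U, (Real.exp a *
            Set.indicator {U : GaugeField (F.P p.K) 0 (SU N) |
              ∀ c ∈ D, ∃ p' ∈ R c, ε'' ≤ dist1 (GaugeField.plaqHol ((avOfRecord F N p.K 0).avg U) p')} (fun _ => (1 : ℝ)) U) *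
            rhoZeroOfRecord F N p.K g₀ E U ∂(fieldMeasure (F.P p.K) 0 (SU N)) ≤
          (Real.exp a * ((m : ℝ) * Real.exp (C * δ₀ - δ₀ * g₀⁻¹ ^ 2 * (ε'' ^ 2 / (2 * (Fintype.card (Fin N) : ℝ))))) ^ D.card) *
            ∫ U, rhoZeroOfRecord F N p.K g₀ E U ∂(fieldMeasure (F.P p.K) 0 (SU N)) := by
  classical
  obtain ⟨δ₀, hδ₀, C, hC, h⟩ := N20LCSAvgCellPeierls.gibbsMeasure_largeFieldCells_dist1_avgFun_le N F.L
  refine ⟨δ₀, hδ₀, C, hC, fun hK g₀ E hg D R m ε'' hε hm hdisj a => ?_⟩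
  have hβ0 : (0 : ℝ) ≤ g₀⁻¹ ^ 2 := sq_nonneg _
  haveI := T4GenFunBounds.isProbabilityMeasure_gibbsMeasure (G := SU N) (F.P p.K) hβ0
  set S : Set (GaugeField (F.P p.K) 0 (SU N)) :=
    {U | ∀ c ∈ D, ∃ p' ∈ R c, ε'' ≤ dist1 (GaugeField.plaqHol ((avOfRecord F N p.K 0).avg U) p')} with hS
  have hSm : MeasurableSet S :=
    (measurableSet_forall_exists_largeField F N ν p g 0 D R ε'').preimage (avOfRecord_measurable F N p.K 0)
  have hρ0 : ∀ U, 0 ≤ rhoZeroOfRecord F N p.K g₀ E U := fun U => (rhoZeroOfRecord_pos F N p.K g₀ E U).le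
  have hρi : Integrable (rhoZeroOfRecord F N p.K g₀ E) (fieldMeasure (F.P p.K) 0 (SU N)) :=
    (Missing.integrable_boltzmann RegularGaugeGroup.measurable_reTr (F.P p.K) hβ0).const_mul _
  have hI0 : 0 ≤ ∫ U, rhoZeroOfRecord F N p.K g₀ E U ∂(fieldMeasure (F.P p.K) 0 (SU N)) := integral_nonneg hρ0
  have hfun : (fun U => (Real.exp a * Set.indicator S (fun _ => (1 : ℝ)) U) * rhoZeroOfRecord F N p.K g₀ E U) =
      fun U => Real.exp a * Set.indicator S (rhoZeroOfRecord F N p.K g₀ E) U := by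
    funext U
    by_cases hU : U ∈ S
    · rw [Set.indicator_of_mem hU, Set.indicator_of_mem hU, mul_one]
    · rw [Set.indicator_of_notMem hU, Set.indicator_of_notMem hU, mul_zero, zero_mul]
  rw [hfun]
  refine ⟨(hρi.indicator hSm).const_mul _, ?_⟩
  rw [integral_const_mul, integral_indicator hSm, setIntegral_rhoZeroOfRecord F N p.K g₀ E hSm, mul_assoc]
  refine mul_le_mul_of_nonneg_left (mul_le_mul_of_nonneg_right ?_ hI0) (Real.exp_pos _).le
  have hmK : 1 ≤ (F.P p.K).m + (F.P p.K).K := by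
    simp only [T4Family.P_m, T4Family.P_K]; omega
  exact h (F.P p.K) (T4Family.P_d F p.K) (T4Family.P_L F p.K) hmK (g₀⁻¹ ^ 2) hg ε'' hε D R m hm hdisj

/-- **THE TWO HALVES OF «LCS-j» JOINTLY INHABITED, BY NAME, AT CUTOFF `1` FOR THE PINNED (3.2) LARGE-FIELD LABELS OF BAŁABAN's STEP WEIGHTS OF
RECORD.**  With the `δ₀ > 0`, `C ≥ 0` of n20-d's cells Peierls bound (functions of `N`, `L` only): on every torus `F.P K` (`K ≥ 1`), for
`g₀⁻² ≥ 4N`, every `E`, every residual fluctuation factor obeying `IsZetaAbsLeOne`, every `A₁`, every level-`0` sequence `s`, every finite family `D`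
of χ₁-cubes with regularity letters on PAIRWISE DISJOINT regions `R c` of at most `m` plaquettes and a common `ε″ ≥ 0` — and for EVERY history tower
`T` over NODE 00's configuration spaces `cfgOfRecord F N K ·` (any choice type, any good classes), every pattern `S`, every level-measure family
with `μ 0 = ∏dU`, every step-kernel family `χ` whose PINNED LEVEL-`0` KERNEL SUM READS the family-pinned label sum of the record on the graph
(`hread` — the identification a label-indexed instance makes by `rfl`), every carrier family whose level-`0` member is
`e^{a 0 g}·𝟙[∀ c∈D, ∃ p′∈R c, ε″ ≤ |Ū(∂p′)−1|]` and all exponents with `e^{a 0 g}·(m·e^{Cδ₀ − δ₀g₀⁻²ε″²∕(2N)})^{#D} ≤ e^{b 0 g}` (`hb`):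
`PointwiseExtraction T S 1 χ M a ∧ LocCondStability T S 1 μ ρ₀ M b`, `ρ₀ = rhoZeroOfRecord F N K g₀ E`.
So at the first pinned step the (α)-road's two named `Prop`s hold TOGETHER for the same carrier, with `b − a = #D·(Cδ₀ + log m − δ₀g₀⁻²ε″²∕(2N))`
NEGATIVE for `ε″ ≫ g₀` — the extracted cost beats the volume cost by `#D` Peierls exponents (`LocalConditionalStability.sum_admS_integral_le_of_LCS`'s
`hcost` at `K = 1`).  Honest: cutoff `1` only (at `j ≥ 1` `LocCondStability` is the located residual, (A1c)); label-indexed reading; two displayed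
letters. [folklore] -/
theorem halves_one_of_record :
    ∃ δ₀ : ℝ, 0 < δ₀ ∧ ∃ C : ℝ, 0 ≤ C ∧ ∀ (_hK : 1 ≤ p.K) (g₀ E : ℝ), 4 * N ≤ g₀⁻¹ ^ 2 →
      ∀ (A₁ : ℝ) {ζ : ZetaOfRecord F N ν M}, IsZetaAbsLeOne F N ν M ζ →
      ∀ (s : SeqOfRecord F ν M g p.K 0) (D : Finset (Iχ F ν p g 0)) (R : Iχ F ν p g 0 → Finset (Plaq (F.P p.K) 1))
        (m : ℕ) (ε'' : ℝ), 0 ≤ ε'' → (∀ c ∈ D, (R c).card ≤ m) →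
        (∀ c₁ ∈ D, ∀ c₂ ∈ D, c₁ ≠ c₂ → Disjoint (R c₁) (R c₂)) →
        (∀ c ∈ D, ∀ V' : GaugeField (F.P p.K) 1 (SU N),
          (∀ p' ∈ R c, dist1 (GaugeField.plaqHol V' p') < ε'') → chiFactor F N ν p g 0 c V' = 1) →
      ∀ {Pat : Type} [DecidableEq Pat] {𝒢 : (j : ℕ) → GoodClass (cfgOfRecord F N p.K j)}
        (T : Tower Pat (fun j => cfgOfRecord F N p.K j) 𝒢) (S : (j : ℕ) → (Fin j → Pat) → Finset Pat)
        (μ : (j : ℕ) → Measure (cfgOfRecord F N p.K j))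
        (χ : (j : ℕ) → (Fin j → Pat) → Pat → cfgOfRecord F N p.K j → ℝ)
        (Mc : (j : ℕ) → (Fin j → Pat) → cfgOfRecord F N p.K j → ℝ) (a b : (j : ℕ) → (Fin j → Pat) → ℝ),
        μ 0 = fieldMeasure (F.P p.K) 0 (SU N) →
        (∀ (h : Fin 0 → Pat) (U : cfgOfRecord F N p.K 0), ∑ q ∈ T.branch 0 h ∩ S 0 h, χ 0 h q U =
          ∑ t ∈ Finset.univ.filter (fun t : LbOfRecord F ν p g 0 => D ⊆ t.1),
            ωOfRecord F N ν M p g 0 A₁ ζ s t U ((avOfRecord F N p.K 0).avg U)) →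
        (∀ (h : Fin 0 → Pat) (U : cfgOfRecord F N p.K 0), Mc 0 h U = Real.exp (a 0 h) *
          Set.indicator {U : GaugeField (F.P p.K) 0 (SU N) |
            ∀ c ∈ D, ∃ p' ∈ R c, ε'' ≤ dist1 (GaugeField.plaqHol ((avOfRecord F N p.K 0).avg U) p')} (fun _ => (1 : ℝ)) U) →
        (∀ h : Fin 0 → Pat, Real.exp (a 0 h) *
          ((m : ℝ) * Real.exp (C * δ₀ - δ₀ * g₀⁻¹ ^ 2 * (ε'' ^ 2 / (2 * (Fintype.card (Fin N) : ℝ))))) ^ D.card ≤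
            Real.exp (b 0 h)) →
        PointwiseExtraction T S 1 χ Mc a ∧ LocCondStability T S 1 μ (rhoZeroOfRecord F N p.K g₀ E) Mc b := by
  obtain ⟨δ₀, hδ₀, C, hC, h⟩ := integral_exp_mul_indicator_rhoZero_le F N ν p g
  refine ⟨δ₀, hδ₀, C, hC, fun hK g₀ E hg A₁ ζ hζ s D R m ε'' hε hm hdisj hreg Pat _ 𝒢 T S μ χ Mc a b hμ hread hM hb =>
    ⟨?_, ?_⟩⟩
  · -- half (i): the pinned kernel sum is at most `e^{−a}·M` pointwise
    intro j gh hj _ U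
    obtain rfl : j = 0 := Nat.lt_one_iff.mp hj
    rw [hread gh U, hM gh U]
    exact sum_ωOfRecord_filter_superset_le_exp_mul_indicator F N ν M p g 0 A₁ hζ s D R ε'' hreg (a 0 gh) U
  · -- half (ii): the carrier is integrable against `ρ₀` and has conditional expectation `≤ e^{b}`
    intro j gh hj _
    obtain rfl : j = 0 := Nat.lt_one_iff.mp hj
    have hMh : Mc 0 gh = fun U => Real.exp (a 0 gh) *
        Set.indicator {U : GaugeField (F.P p.K) 0 (SU N) |
          ∀ c ∈ D, ∃ p' ∈ R c, ε'' ≤ dist1 (GaugeField.plaqHol ((avOfRecord F N p.K 0).avg U) p')} (fun _ => (1 : ℝ)) U :=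
      funext (hM gh)
    show Integrable (fun y => Mc 0 gh y * rhoZeroOfRecord F N p.K g₀ E y) (μ 0) ∧
      ∫ y, Mc 0 gh y * rhoZeroOfRecord F N p.K g₀ E y ∂μ 0 ≤
        Real.exp (b 0 gh) * ∫ y, rhoZeroOfRecord F N p.K g₀ E y ∂μ 0
    rw [hMh, hμ]
    obtain ⟨hint, hle⟩ := h hK g₀ E hg D R m ε'' hε hm hdisj (a 0 gh)
    refine ⟨hint, hle.trans (mul_le_mul_of_nonneg_right (hb gh)
      (integral_nonneg fun U => (rhoZeroOfRecord_pos F N p.K g₀ E U).le))⟩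

end Summit.QuantumFields.YangMills.BalabanUVNodes.N20LCSLargeFieldHalves

end

/-! ### Erratum (g4, 2026-08-27) — citation pointer, prose only
In the prose of this file «[Balaban1985PropagatorsII] Thm 1» ∕ «CMP 99 (1985) 389–434» denotes T. Bałaban, *The variational problem and
background fields in renormalization group method for lattice gauge theories*, Commun. Math. Phys. **102** (1985) 277–309 — bib key
`Balaban1985Variational` —, Theorem 1 p. 279 (for data with `|∂V(p′) − 1| < ε₁ ≤ a₁` there is a minimal orbit in
`U_k({𝔅_j}, B₃ε₁) ∩ 𝔘_k(𝔅_k, V)`, the unique critical orbit for `B₃ε₁ ≤ ε₀ ≤ a₀`, with the local regularity (9)–(10)); there is no bib key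
`Balaban1985PropagatorsII`.  The regularity letter `hreg` is that theorem's shape at def-R's (2.16) problem.  Statements are unaffected. -/
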